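import Literature.IUT.LogThetaLattice.GlobalPacketsLGPNegative33i
import HarnessLib

/-!
# [IUTchIII] Prop 3.3 (i): the UNPRIMED schema `Prop33i_directSumOfNumberFields` is refuted by the same witness

Proof-only supplement (abc-iut cell, FACT-LIST rule R5 «refuted is never a fact», plan 23:46:05Z) to
`GlobalPacketsLGPNegative33i.lean`: the unprimed schema `Prop33i_directSumOfNumberFields` of
`GlobalPacketsLGP.lean` (abc-iut-L6-t4, [IUTchIII] Proposition 3.3 (i) p. 100, typed WITHOUT the
`[NumberField]` binder) has the SAME signature and body as the primed `Prop33i_directSumOfNumberFields'`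
(finding G-BINDER-DROP), so the landed countable/uncountable witness `not_Prop33i_directSumOfNumberFields'_real`
refutes it verbatim at `A := Unit`, `F := fun _ => ℝ`. Consequence for plan/FACT-LIST.md: rows F-2098
(`Prop33i_directSumOfNumberFields`, «witness-candidate») and F-2099 (`…'`, «fact-open») are NOT admissible
facts in universal form (R5); the TRUE content is the named-instance theorems
`Prop33i_directSumOfNumberFields_of_numberField` / `…'_of_numberField` (p405908) and the binder-carrying
`Prop33i_directSumOfNumberFields''` with `Prop33i_directSumOfNumberFields''_holds` (GlobalPacketsLGPProofs).
Mochizuki's Proposition 3.3 (i) concerns number fields `(†𝕄⊛_mod)_α ≅ F_mod`; nothing here bears on it or on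
Cor. 3.12 — typing record only; no side taken. [claim: Mochizuki2012, status: disputed]
-/

namespace Literature.IUT.LogThetaLattice

/-- The unprimed schema `Prop33i_directSumOfNumberFields` ([IUTchIII] Prop 3.3 (i) p.100 typed without
its `[NumberField]` binder) is FALSE at the junk parameter `A := Unit`, `F := fun _ => ℝ` — the very term
of `not_Prop33i_directSumOfNumberFields'_real` (the two schemas are definitionally equal).
[claim: Mochizuki2012, status: disputed] -/
theorem not_Prop33i_directSumOfNumberFields_real :
    ¬ Prop33i_directSumOfNumberFields (A := Unit) (fun _ => ℝ) :=
  not_Prop33i_directSumOfNumberFields'_real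

/-- Hence the universal closure of the schema is refutable: it is not the case that EVERY finite family
of fields over `ℚ` has a global packet isomorphic to a finite product of number fields (FACT-LIST rule R5:
a refuted universal form is never an admissible fact; consume the `_of_numberField` instances or the
binder-carrying `Prop33i_directSumOfNumberFields''_holds` instead). [claim: Mochizuki2012, status: disputed] -/
theorem not_forall_Prop33i_directSumOfNumberFields :
    ¬ ∀ (A : Type) (_ : Fintype A) (_ : DecidableEq A) (F : A → Type) (_ : ∀ α, Field (F α))
        (_ : ∀ α, Algebra ℚ (F α)), Prop33i_directSumOfNumberFields F :=
  fun h => not_Prop33i_directSumOfNumberFields_real (h Unit inferInstance inferInstance _ _ _)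

end Literature.IUT.LogThetaLattice
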